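import Mathlib
import HarnessLib
import Summits.HubbardSuperconductivity.HubbardSuperconductivity.Theorems.KLProgrammeCutCurrencyWeightedFactorisation

/-!
# Route `KLProgramme` — ENGINE (stmt-HubbardSuperconductivity-20437 `KLRegimeEngineV17F2`), located #25 «(b)-PLAIN-UV-TAIL», cure (α),
# E1 item (i) towards the WEIGHTED rows: the TIME-WEIGHTED pinned currency identity for a frequency-weighted bare vertex, and the FIRST-MOMENT
# CURRENCY of the UV-cut vertex `≤ (|U|/24)·8·M₁·A³` (cell gate-hubbard-kl, seat hubbard-kl-k3c2-p2 g35)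

* `klbv_timeWeightedCurrency_hubbardInteraction_freqMul_eq` — ✓ p773994's identity with an arbitrary TIME weight `wt(t(x))` inserted:
  `ε_x³ Σ_{x′ : x′_q = y} wt(t(x′))·‖W₄^c(V)(x′)‖ = (|U|/24)·(2M)⁻³·Σ_{t : t_q = y₀} wt(t)·|S^c_time(t)|` (spatial locality of `V`: `klbv_pinned_split`);
* `klbv_timeWeightedCurrency_uvCut_hubbardInteraction_eq` — the same for the UV-cut vertex `S_ĝ V` (bridge ✓ `klbv_sectorisedKernel_uvCut_hubbardInteraction_eq`);
* **`klbv_firstMomentCurrency_uvCut_hubbardInteraction_le`** — with the tree weight's time part `Σ_i (β/2M)·d_{2M}(t_i − t_q)` (torus distance of the imaginary times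
  to the pinned leg, in physical units): for `2 ≤ β ≤ M`,
  `ε_x³ Σ_{x′ : x′_q = y} (Σ_i (β/2M)·d_{2M}(t′_i − t′_q))·‖W₄(S_ĝ V)(x′)‖ ≤ (|U|/24)·8·M₁·A³`,
  `A = (2M)⁻¹Σ_j|ĉ(j)|` (`≤ 15`, ✓-farm `…LegMassNumeric`), `M₁ = (2M)⁻¹Σ_j (β·d_{2M}(j)/2M)|ĉ(j)|` (β/M-explicit bound ✓-farm `…FirstMomentBound`).
  Since `klScaleWt_n(x′) ≤ 1 + 2Λ_n·Σ_i d(τ′_i, τ′_q)` on spatially coincident tuples, this and `…LegMassNumeric` give the O(U) (tree-level) part of binder #6's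
  weighted cut plain row at the vertex pattern, up to the `gridLabelDist`/`klScaleWt` plumbing (successor).
No definition; nothing asserts any row, (b), (C), K3, U₀, the window or superconductivity.
References: BGM 2006 §2.1 (2.5)–(2.6a), §2.3 (2.17), §3 [cite: BenfattoGiulianiMastropietro2006].
-/

noncomputable section

namespace Summit.HubbardSuperconductivity.HubbardSuperconductivity.Theorems.KLRegimeSplit

set_option linter.dupNamespace false -- summit = problem name (single-conjunct summit), D-0017

open Finset Literature.MathematicalPhysics.QuantumLattice Literature.Probability.LatticeModels GrassmannAlgebra
open scoped ComplexConjugate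

variable {L M : ℕ} [NeZero L] [NeZero M]

/-! ## §1 The time-weighted pinned currency of a frequency-weighted bare vertex -/

/-- **TIME-WEIGHTED PINNED CURRENCY OF THE BARE VERTEX WITH A FREQUENCY MULTIPLIER** (`0 < β`; any time weight `wt`):
`ε_x³ · Σ_{x′ : x′_q = y} wt(t(x′)) ‖W₄^c(V)(x′)‖ = (|U|/24) · (2M)⁻³ · Σ_{t : t_q = y₀} wt(t) |S^c_time(t)|`. -/
theorem klbv_timeWeightedCurrency_hubbardInteraction_freqMul_eq {β : ℝ} (hβ : 0 < β) (U : ℝ) (c : MatsubaraIdx M → ℂ) (q : Fin 4) (y : SpaceTimeIdx L M)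
    (wt : (Fin 4 → ImagTimeIdx M) → ℝ) :
    imagTimeWeight β M ^ 3 *
        ∑ x ∈ univ.filter (fun x : Fin 4 → SpaceTimeIdx L M => x q = y),
          wt (fun i => (x i).1) * ‖sectorisedKernel L M β (fun (_ : Fin 1) (k : FreqMomentum L M) => c k.1) (hubbardInteraction L M β U) 4
            (![(((0 : Fin 1), (0 : Fin 2)), (0 : Fin 2)), ((0, 0), 1), ((0, 1), 0), ((0, 1), 1)] : Fin 4 → SectorLeg 1) x‖ =
      |U| / 24 * ((((2 * M : ℕ) : ℝ) ^ 3)⁻¹ *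
        ∑ t ∈ univ.filter (fun t : Fin 4 → ImagTimeIdx M => t q = y.1),
          wt t * ‖∑ n : Fin 4 → MatsubaraIdx M,
              if matsubaraInt M (n 0) + matsubaraInt M (n 2) = matsubaraInt M (n 1) + matsubaraInt M (n 3) then
                (∏ i : Fin 4, c (n i)) * ∏ i : Fin 4, Complex.exp (-((chargeSign ((![(((0 : Fin 1), (0 : Fin 2)), (0 : Fin 2)), ((0, 0), 1), ((0, 1), 0), ((0, 1), 1)] : Fin 4 → SectorLeg 1) i).2 * (matsubaraFreq β M (n i) * imagTime β M (t i)) : ℝ) : ℂ) * Complex.I)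
              else 0‖) := by
  have hL : (0 : ℝ) < L := by exact_mod_cast Nat.pos_of_ne_zero (NeZero.ne L)
  have hM : (0 : ℝ) < ((2 * M : ℕ) : ℝ) := by
    have := NeZero.ne M
    exact_mod_cast (by omega : 0 < 2 * M)
  set S : (Fin 4 → ImagTimeIdx M) → ℂ := fun t => ∑ n : Fin 4 → MatsubaraIdx M,
      if matsubaraInt M (n 0) + matsubaraInt M (n 2) = matsubaraInt M (n 1) + matsubaraInt M (n 3) then
        (∏ i : Fin 4, c (n i)) * ∏ i : Fin 4, Complex.exp (-((chargeSign ((![(((0 : Fin 1), (0 : Fin 2)), (0 : Fin 2)), ((0, 0), 1), ((0, 1), 0), ((0, 1), 1)] : Fin 4 → SectorLeg 1) i).2 * (matsubaraFreq β M (n i) * imagTime β M (t i)) : ℝ) : ℂ) * Complex.I)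
      else 0 with hSdef
  have h24 : (((4 : ℕ).factorial : ℚ)⁻¹ • (1 : ℂ)) = ((24 : ℂ))⁻¹ := by
    rw [Rat.smul_one_eq_cast]; push_cast; norm_num [Nat.factorial]
  have hK : ‖((((U / (β * (L : ℝ) ^ 2) ^ 3 : ℝ)) : ℂ) * (((4 : ℕ).factorial : ℚ)⁻¹ • (1 : ℂ)))‖ = |U| / (β * (L : ℝ) ^ 2) ^ 3 / 24 := by
    rw [h24, norm_mul, Complex.norm_real, norm_inv, Real.norm_eq_abs, abs_div, abs_of_pos (by positivity : (0 : ℝ) < (β * (L : ℝ) ^ 2) ^ 3)]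
    norm_num [div_eq_mul_inv]
  -- pointwise: weight × kernel norm = (time function) × coincidence
  have hx : ∀ x : Fin 4 → SpaceTimeIdx L M,
      wt (fun i => (x i).1) * ‖sectorisedKernel L M β (fun (_ : Fin 1) (k : FreqMomentum L M) => c k.1) (hubbardInteraction L M β U) 4
          (![(((0 : Fin 1), (0 : Fin 2)), (0 : Fin 2)), ((0, 0), 1), ((0, 1), 0), ((0, 1), 1)] : Fin 4 → SectorLeg 1) x‖ =
        (fun t : Fin 4 → ImagTimeIdx M => wt t * (|U| / (β * (L : ℝ) ^ 2) ^ 3 / 24 * ‖S t‖)) (fun i => (x i).1) *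
          (if (x 0).2 = (x 3).2 ∧ (x 1).2 = (x 3).2 ∧ (x 2).2 = (x 3).2 then ((L : ℝ) ^ 6) else 0) := by
    intro x
    rw [klbv_positionKernel_hubbardInteraction_freqMul_eq, norm_mul, hK, norm_mul, klbv_norm_coincidence (fun i => (x i).2)]
    simp only [hSdef]
    ring
  rw [klbv_pinned_split _ (fun t : Fin 4 → ImagTimeIdx M => wt t * (|U| / (β * (L : ℝ) ^ 2) ^ 3 / 24 * ‖S t‖)) ((L : ℝ) ^ 6) q y hx, imagTimeWeight]
  show _ = |U| / 24 * ((((2 * M : ℕ) : ℝ) ^ 3)⁻¹ * ∑ t ∈ univ.filter (fun t : Fin 4 → ImagTimeIdx M => t q = y.1), wt t * ‖S t‖)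
  have hβ0 : β ≠ 0 := hβ.ne'
  rw [Finset.mul_sum, Finset.mul_sum, Finset.mul_sum, Finset.mul_sum]
  refine Finset.sum_congr rfl (fun t _ => ?_)
  push_cast
  field_simp

/-- **TIME-WEIGHTED PINNED CURRENCY OF THE UV-CUT BARE VERTEX** (`0 < β`; any time weight `wt`): the same identity for `S_ĝ V`. -/
theorem klbv_timeWeightedCurrency_uvCut_hubbardInteraction_eq {β : ℝ} (hβ : 0 < β) (U : ℝ) (q : Fin 4) (y : SpaceTimeIdx L M)
    (wt : (Fin 4 → ImagTimeIdx M) → ℝ) :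
    imagTimeWeight β M ^ 3 *
        ∑ x ∈ univ.filter (fun x : Fin 4 → SpaceTimeIdx L M => x q = y),
          wt (fun i => (x i).1) * ‖sectorisedKernel L M β (trivialMultiplier L M)
            (ExteriorAlgebra.map (LinearMap.mulLeft ℂ (fun K : HubbardFieldIdx L M => ((gnScaleCutoff 4 klE0 1 |matsubaraFreq β M K.1.1.1| : ℝ) : ℂ))) (hubbardInteraction L M β U)) 4
            (![(((0 : Fin 1), (0 : Fin 2)), (0 : Fin 2)), ((0, 0), 1), ((0, 1), 0), ((0, 1), 1)] : Fin 4 → SectorLeg 1) x‖ =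
      |U| / 24 * ((((2 * M : ℕ) : ℝ) ^ 3)⁻¹ *
        ∑ t ∈ univ.filter (fun t : Fin 4 → ImagTimeIdx M => t q = y.1),
          wt t * ‖∑ n : Fin 4 → MatsubaraIdx M,
              if matsubaraInt M (n 0) + matsubaraInt M (n 2) = matsubaraInt M (n 1) + matsubaraInt M (n 3) then
                (∏ i : Fin 4, (((gnScaleCutoff 4 klE0 1 |matsubaraFreq β M (n i)| : ℝ) : ℂ))) *
                  ∏ i : Fin 4, Complex.exp (-((chargeSign ((![(((0 : Fin 1), (0 : Fin 2)), (0 : Fin 2)), ((0, 0), 1), ((0, 1), 0), ((0, 1), 1)] : Fin 4 → SectorLeg 1) i).2 * (matsubaraFreq β M (n i) * imagTime β M (t i)) : ℝ) : ℂ) * Complex.I)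
              else 0‖) := by
  simp_rw [klbv_sectorisedKernel_uvCut_hubbardInteraction_eq]
  exact klbv_timeWeightedCurrency_hubbardInteraction_freqMul_eq hβ U (fun i : MatsubaraIdx M => (((gnScaleCutoff 4 klE0 1 |matsubaraFreq β M i| : ℝ) : ℂ))) q y wt

/-! ## §2 The first-moment currency of the UV-cut vertex -/

/-- **THE FIRST-MOMENT (TREE-WEIGHT) CURRENCY OF THE UV-CUT BARE VERTEX** (`2 ≤ β ≤ M`): with the physical torus time-distances to the pinned leg,
`ε_x³ Σ_{x′ : x′_q = y} (Σ_i (β/2M)·d_{2M}(t′_i − t′_q))·‖W₄(S_ĝ V)(x′)‖ ≤ (|U|/24)·8·M₁·A³`,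
`A = (2M)⁻¹Σ_j|ĉ(j)|`, `M₁ = (2M)⁻¹Σ_j (β·d_{2M}(j)/2M)·|ĉ(j)|`, `ĉ(j) = Σ_v ĝ(ω_v)e^{−2πivj/2M}`. -/
theorem klbv_firstMomentCurrency_uvCut_hubbardInteraction_le {β : ℝ} (hβ : 2 ≤ β) (hM : β ≤ M) (U : ℝ) (q : Fin 4) (y : SpaceTimeIdx L M) :
    imagTimeWeight β M ^ 3 *
        ∑ x ∈ univ.filter (fun x : Fin 4 → SpaceTimeIdx L M => x q = y),
          (∑ i : Fin 4, β / ((2 * M : ℕ) : ℝ) * min (((((x i).1 - (x q).1 : ImagTimeIdx M)) : ℕ) : ℝ) (((2 * M : ℕ) : ℝ) - ((((x i).1 - (x q).1 : ImagTimeIdx M)) : ℕ))) *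
          ‖sectorisedKernel L M β (trivialMultiplier L M)
            (ExteriorAlgebra.map (LinearMap.mulLeft ℂ (fun K : HubbardFieldIdx L M => ((gnScaleCutoff 4 klE0 1 |matsubaraFreq β M K.1.1.1| : ℝ) : ℂ))) (hubbardInteraction L M β U)) 4
            (![(((0 : Fin 1), (0 : Fin 2)), (0 : Fin 2)), ((0, 0), 1), ((0, 1), 0), ((0, 1), 1)] : Fin 4 → SectorLeg 1) x‖ ≤
      |U| / 24 * (8 *
        ((((2 * M : ℕ) : ℝ))⁻¹ * ∑ j : ImagTimeIdx M, (β * min ((j : ℕ) : ℝ) (((2 * M : ℕ) : ℝ) - (j : ℕ)) / ((2 * M : ℕ) : ℝ)) *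
          ‖∑ n : MatsubaraIdx M, (((gnScaleCutoff 4 klE0 1 |matsubaraFreq β M n| : ℝ) : ℂ)) *
            Complex.exp (-((2 * Real.pi * ((n : ℕ) : ℝ) * ((j : ℕ) : ℝ) / (2 * M) : ℝ) : ℂ) * Complex.I)‖) *
        ((((2 * M : ℕ) : ℝ))⁻¹ * ∑ j : ImagTimeIdx M, ‖∑ n : MatsubaraIdx M, (((gnScaleCutoff 4 klE0 1 |matsubaraFreq β M n| : ℝ) : ℂ)) *
            Complex.exp (-((2 * Real.pi * ((n : ℕ) : ℝ) * ((j : ℕ) : ℝ) / (2 * M) : ℝ) : ℂ) * Complex.I)‖) ^ 3) := by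
  have hβ0 : 0 < β := by linarith
  have hMne := NeZero.ne M
  have hN : (0 : ℝ) < ((2 * M : ℕ) : ℝ) := by exact_mod_cast (by omega : 0 < 2 * M)
  -- the identity with the time weight `wt t = Σ_i (β/N) d_N(t_i − t_q)`
  rw [klbv_timeWeightedCurrency_uvCut_hubbardInteraction_eq hβ0 U q y
    (fun t : Fin 4 → ImagTimeIdx M => ∑ i : Fin 4, β / ((2 * M : ℕ) : ℝ) *
      min ((((t i - t q : ImagTimeIdx M)) : ℕ) : ℝ) (((2 * M : ℕ) : ℝ) - (((t i - t q : ImagTimeIdx M)) : ℕ)))]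
  -- inside the pinned sum `t_q = y.1`
  have hpin : ∑ t ∈ univ.filter (fun t : Fin 4 → ImagTimeIdx M => t q = y.1),
      (∑ i : Fin 4, β / ((2 * M : ℕ) : ℝ) * min ((((t i - t q : ImagTimeIdx M)) : ℕ) : ℝ) (((2 * M : ℕ) : ℝ) - (((t i - t q : ImagTimeIdx M)) : ℕ))) *
        ‖∑ n : Fin 4 → MatsubaraIdx M,
            if matsubaraInt M (n 0) + matsubaraInt M (n 2) = matsubaraInt M (n 1) + matsubaraInt M (n 3) then
              (∏ i : Fin 4, (((gnScaleCutoff 4 klE0 1 |matsubaraFreq β M (n i)| : ℝ) : ℂ))) *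
                ∏ i : Fin 4, Complex.exp (-((chargeSign ((![(((0 : Fin 1), (0 : Fin 2)), (0 : Fin 2)), ((0, 0), 1), ((0, 1), 0), ((0, 1), 1)] : Fin 4 → SectorLeg 1) i).2 * (matsubaraFreq β M (n i) * imagTime β M (t i)) : ℝ) : ℂ) * Complex.I)
            else 0‖ =
      β / ((2 * M : ℕ) : ℝ) * ∑ t ∈ univ.filter (fun t : Fin 4 → ImagTimeIdx M => t q = y.1),
        (∑ i : Fin 4, min ((((t i - y.1 : ImagTimeIdx M)) : ℕ) : ℝ) (((2 * M : ℕ) : ℝ) - (((t i - y.1 : ImagTimeIdx M)) : ℕ))) *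
        ‖∑ n : Fin 4 → MatsubaraIdx M,
            if matsubaraInt M (n 0) + matsubaraInt M (n 2) = matsubaraInt M (n 1) + matsubaraInt M (n 3) then
              (∏ i : Fin 4, (((gnScaleCutoff 4 klE0 1 |matsubaraFreq β M (n i)| : ℝ) : ℂ))) *
                ∏ i : Fin 4, Complex.exp (-((chargeSign ((![(((0 : Fin 1), (0 : Fin 2)), (0 : Fin 2)), ((0, 0), 1), ((0, 1), 0), ((0, 1), 1)] : Fin 4 → SectorLeg 1) i).2 * (matsubaraFreq β M (n i) * imagTime β M (t i)) : ℝ) : ℂ) * Complex.I)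
            else 0‖ := by
    rw [Finset.mul_sum]
    refine Finset.sum_congr rfl (fun t ht => ?_)
    have htq : t q = y.1 := (Finset.mem_filter.mp ht).2
    rw [htq, ← Finset.mul_sum]
    ring
  rw [hpin]
  have hmain : ∑ t ∈ univ.filter (fun t : Fin 4 → ImagTimeIdx M => t q = y.1),
        (∑ i : Fin 4, min ((((t i - y.1 : ImagTimeIdx M)) : ℕ) : ℝ) (((2 * M : ℕ) : ℝ) - (((t i - y.1 : ImagTimeIdx M)) : ℕ))) *
        ‖∑ n : Fin 4 → MatsubaraIdx M,
            if matsubaraInt M (n 0) + matsubaraInt M (n 2) = matsubaraInt M (n 1) + matsubaraInt M (n 3) then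
              (∏ i : Fin 4, (((gnScaleCutoff 4 klE0 1 |matsubaraFreq β M (n i)| : ℝ) : ℂ))) *
                ∏ i : Fin 4, Complex.exp (-((chargeSign ((![(((0 : Fin 1), (0 : Fin 2)), (0 : Fin 2)), ((0, 0), 1), ((0, 1), 0), ((0, 1), 1)] : Fin 4 → SectorLeg 1) i).2 * (matsubaraFreq β M (n i) * imagTime β M (t i)) : ℝ) : ℂ) * Complex.I)
            else 0‖ ≤
      8 * (((2 * M : ℕ) : ℝ))⁻¹ *
        (∑ j : ImagTimeIdx M, min ((j : ℕ) : ℝ) (((2 * M : ℕ) : ℝ) - (j : ℕ)) *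
          ‖∑ n : MatsubaraIdx M, (((gnScaleCutoff 4 klE0 1 |matsubaraFreq β M n| : ℝ) : ℂ)) *
            Complex.exp (-((2 * Real.pi * ((n : ℕ) : ℝ) * ((j : ℕ) : ℝ) / (2 * M) : ℝ) : ℂ) * Complex.I)‖) *
        (∑ j : ImagTimeIdx M, ‖∑ n : MatsubaraIdx M, (((gnScaleCutoff 4 klE0 1 |matsubaraFreq β M n| : ℝ) : ℂ)) *
            Complex.exp (-((2 * Real.pi * ((n : ℕ) : ℝ) * ((j : ℕ) : ℝ) / (2 * M) : ℝ) : ℂ) * Complex.I)‖) ^ 3 :=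
    klct_pinnedTimeSum_firstMoment_le hβ0.ne' (fun i : MatsubaraIdx M => (((gnScaleCutoff 4 klE0 1 |matsubaraFreq β M i| : ℝ) : ℂ)))
      (fun n hn => klct_uvCut_support hβ hM n hn) q y.1
  have hinner : ∑ j : ImagTimeIdx M, (β * min ((j : ℕ) : ℝ) (((2 * M : ℕ) : ℝ) - (j : ℕ)) / ((2 * M : ℕ) : ℝ)) *
        ‖∑ n : MatsubaraIdx M, (((gnScaleCutoff 4 klE0 1 |matsubaraFreq β M n| : ℝ) : ℂ)) *
          Complex.exp (-((2 * Real.pi * ((n : ℕ) : ℝ) * ((j : ℕ) : ℝ) / (2 * M) : ℝ) : ℂ) * Complex.I)‖ =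
      β / ((2 * M : ℕ) : ℝ) * ∑ j : ImagTimeIdx M, min ((j : ℕ) : ℝ) (((2 * M : ℕ) : ℝ) - (j : ℕ)) *
        ‖∑ n : MatsubaraIdx M, (((gnScaleCutoff 4 klE0 1 |matsubaraFreq β M n| : ℝ) : ℂ)) *
          Complex.exp (-((2 * Real.pi * ((n : ℕ) : ℝ) * ((j : ℕ) : ℝ) / (2 * M) : ℝ) : ℂ) * Complex.I)‖ := by
    rw [Finset.mul_sum]
    exact Finset.sum_congr rfl (fun j _ => by ring)
  rw [hinner]
  -- name the three sums and finish by algebra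
  generalize (∑ t ∈ univ.filter (fun t : Fin 4 → ImagTimeIdx M => t q = y.1),
        (∑ i : Fin 4, min ((((t i - y.1 : ImagTimeIdx M)) : ℕ) : ℝ) (((2 * M : ℕ) : ℝ) - (((t i - y.1 : ImagTimeIdx M)) : ℕ))) *
        ‖∑ n : Fin 4 → MatsubaraIdx M,
            if matsubaraInt M (n 0) + matsubaraInt M (n 2) = matsubaraInt M (n 1) + matsubaraInt M (n 3) then
              (∏ i : Fin 4, (((gnScaleCutoff 4 klE0 1 |matsubaraFreq β M (n i)| : ℝ) : ℂ))) *
                ∏ i : Fin 4, Complex.exp (-((chargeSign ((![(((0 : Fin 1), (0 : Fin 2)), (0 : Fin 2)), ((0, 0), 1), ((0, 1), 0), ((0, 1), 1)] : Fin 4 → SectorLeg 1) i).2 * (matsubaraFreq β M (n i) * imagTime β M (t i)) : ℝ) : ℂ) * Complex.I)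
            else 0‖) = Tsum at hmain ⊢
  generalize (∑ j : ImagTimeIdx M, min ((j : ℕ) : ℝ) (((2 * M : ℕ) : ℝ) - (j : ℕ)) *
          ‖∑ n : MatsubaraIdx M, (((gnScaleCutoff 4 klE0 1 |matsubaraFreq β M n| : ℝ) : ℂ)) *
            Complex.exp (-((2 * Real.pi * ((n : ℕ) : ℝ) * ((j : ℕ) : ℝ) / (2 * M) : ℝ) : ℂ) * Complex.I)‖) = MomS at hmain ⊢
  generalize (∑ j : ImagTimeIdx M, ‖∑ n : MatsubaraIdx M, (((gnScaleCutoff 4 klE0 1 |matsubaraFreq β M n| : ℝ) : ℂ)) *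
            Complex.exp (-((2 * Real.pi * ((n : ℕ) : ℝ) * ((j : ℕ) : ℝ) / (2 * M) : ℝ) : ℂ) * Complex.I)‖) = MassS at hmain ⊢
  have hcoef : 0 ≤ |U| / 24 * ((((2 * M : ℕ) : ℝ) ^ 3)⁻¹ * (β / ((2 * M : ℕ) : ℝ))) := by positivity
  calc |U| / 24 * ((((2 * M : ℕ) : ℝ) ^ 3)⁻¹ * (β / ((2 * M : ℕ) : ℝ) * Tsum))
      = |U| / 24 * ((((2 * M : ℕ) : ℝ) ^ 3)⁻¹ * (β / ((2 * M : ℕ) : ℝ))) * Tsum := by ring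
    _ ≤ |U| / 24 * ((((2 * M : ℕ) : ℝ) ^ 3)⁻¹ * (β / ((2 * M : ℕ) : ℝ))) * (8 * (((2 * M : ℕ) : ℝ))⁻¹ * MomS * MassS ^ 3) :=
        mul_le_mul_of_nonneg_left hmain hcoef
    _ = _ := by field_simp

end Summit.HubbardSuperconductivity.HubbardSuperconductivity.Theorems.KLRegimeSplit

end
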